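import Literature.AnabelianGeometry.EtaleTheta.ThetaTwistTowerComapLevel
import Literature.AnabelianGeometry.EtaleTheta.LogDivisorTowerComap
import Literature.AnabelianGeometry.EtaleTheta.TemperedFrobenioidOfThetaTwistTowerSmallIndex

/-!
# [EtTh] Def. 3.6 (ii) at the ε-free `(β)` theta tower RESTRICTED TO A TEMPERED SUBGROUP `G ≤ Compat₃′`: the tower model over
# `B^temp(G)⁰` with small index `CosetCat G` (Def. 3.3 (iii) p.299, Def. 3.6 pp.302–303 / PDF pp.73, 76–77)

S. Mochizuki, *The étale theta function …*, Publ. RIMS **45** (2009) [MochizukiEtTh2009], Def. 3.3 (iii) pp.299–300 (PDF pp.73–74), Prop. 3.4 p.300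
(PDF p.74), Def. 3.6 (i)(ii) pp.302–303 (PDF pp.76–77); S. Mochizuki, *The geometry of Frobenioids I* (2008), Thm. 5.2 (ii) p.100; *… II* (2008),
Ex. 1.3 (i) p.11; *Semi-graphs of anabelioids* (2006), Def. 3.1 (i) p.33.  [cite: MochizukiEtTh2009, Def 3.6 p.303 (PDF p.77)]
PAGE CONVENTION for [EtTh]: «printed N (PDF p.M)», N = M + 226.

abc-iut cell, layer L2, seat abc-iut-L2-t3 (gen 10; [EtTh] §3/§4 lineage, `LogDivisorTower` / `towerC₃sf` / `ofPowDiagonalBase` / `settingSmall` owner),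
row «(β2) COMAP-TOWER fourth-model twin over `CosetCat G`» (abc-iut-L2-lead R1257 / R1277) = step (β2-A) of the S2-repair of record of the §5
junction: (α) `mkOfClosureRange` (p504894) wants a tempered Frobenioid over `B^temp(closure(Im φ))⁰`; this file BUILDS IT for every tempered
subgroup `G ≤ Compat₃′` (closed ⇒ tempered), by abc-iut-L2-d2's FILE-4 recipe (p493549) re-indexed as in p501267, over abc-iut-L2-t2's comapped
tower `towerC₃sf.comap` (p505912/p506639) and abc-iut-L2-t3's comap kits (p505827 level data, p506809 torsion).  CLASS (b) construction
(abbrevs/defs + laws); ADDITIVE; no instance / notation / Prop fact / sorry; every FILE-4 lemma is consumed BY NAME at `ψ := G.subtype`.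
* §1 `towerSub G` (the comapped tower at `levelsC`: `e := id`, `he := closureC_antitone`, `hb := exists_closureC_subset_of_isOpen`), the reading
  level `lvlG Y := rep (lvl Y)`, `dmG := ofTower (towerSub G)`; the transition formula **`Φ₀_map_hom_eq_sub`** («pull back, then `(−)^{eN}`»,
  `rfl` over abc-iut-L2-t2's `ofTower_comap_Φ₀_map_apply`), `lvlG_le_of_hom` (`le_of_closureC_le`), `Φ₀_map_injective_sub` /
  `Φ₀_map_reflects_dvd_sub` (abc-iut-L2-t3's `TateTowerTheta.pow_left_injective` / `theta_pow_dvd_pow_iff` at `φ := φ₃ ∘ G.subtype`).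
* §2 the SMALL index: `dmSubSmall := dmG.precomp (CosetCat.toConnected hG)`, `hpfSubSmall`, and **`powDiagonalBaseSub`** (F := the equivalence
  inverse; fields = FILE 4's at the coset re-presentation `reprG A`, through the kits).
* §3 **`temperedFrobenioidSub hG R S`** — Def. 3.6 (ii) over `B^temp(G)⁰` of monoid type `ℤ`: a Frobenioid (`hB₀inj` := the GENERIC
  `LogDivisorTower.ofTower_B₀_map_injective` at `towerSub G`), `Φ` perfect, base full / essentially surjective, `Φ^{bs-fld} ⊊ Φ` at EVERY covering
  (the class of `Θ̈`'s zeros), and the [FrdI] Thm. 5.2 hypotheses `h` (`hypotheses_temperedFrobenioidSub`, p504077 pattern).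
NOT HERE: the E2 root law / A10 over `B^temp(G)⁰` ((β2-B) `Discharge/Sec4RootLawThetaTwistTowerSubgroup.lean`) and the §4/§5 socket at
`G := closureRange φ` ((β3) `Discharge/Sec5JunctionClosureRange.lean`).  HONEST LABEL: a class-(b) combinatorial DESIGN model (finite groups of roots of
unity adjoined level-wise to the `Ÿ`-skeleton, read over the `G`-sets of a subgroup), NOT the tempered Frobenioid of a Tate curve; the (β) deviation of
record (torsion sign of Prop. 1.4 (ii) not carried) stands; [EtTh]/[FrdI]/[FrdII]/[SemiAnbd] are refereed prerequisite papers; nothing here bears on, or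
takes a side on, the disputed [IUTchIII] Cor. 3.12; nothing here asserts abc proved or refuted; typed ≠ proved.
-/

noncomputable section

namespace Literature.AnabelianGeometry.EtaleTheta

open CategoryTheory Opposite Function Literature.AlgebraicGeometry.Frobenioids Literature.AnabelianGeometry.SemiGraphs
  Literature.AnabelianGeometry.SemiGraphs.GaloisObjects LogDivisorModel LogDivisorModel.GaloisAction LogDivisorTower
  TateTowerKummerTwistRShear LogDivisorModel.TateTowerThetaTwist

namespace ThetaTwistTowerSubgroup

open ThetaTwistTowerTempered
open TateTowerKummerTwist (N eN eN_pos)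

/-! ## §1 The comapped theta tower over the `G`-sets of a subgroup `G ≤ Compat₃′` -/

/-- The level chain of «GRP₃′» is antitone (input `he` of abc-iut-L2-t2's `comapNat`). [cite: MochizukiEtTh2009, Def 3.3 (i) p.298 (PDF p.72)] -/
theorem heC : ∀ ⦃n m : ℕ⦄, n ≤ m → (levelsC 3 thetaShear).closure (id m) ≤ (levelsC 3 thetaShear).closure (id n) :=
  fun _ _ h => closureC_antitone 3 thetaShear h

/-- Every open neighbourhood of `1` in `Compat₃′` contains a level (input `hb` of `comapNat`). [cite: MochizukiEtTh2009, Def 3.3 (i) p.298 (PDF p.72)] -/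
theorem hbC : ∀ U : Set (Compat 3 thetaShear), IsOpen U → (1 : Compat 3 thetaShear) ∈ U →
    ∃ n, ((levelsC 3 thetaShear).closure (id n) : Set (Compat 3 thetaShear)) ⊆ U :=
  fun _ hU h1 => exists_closureC_subset_of_isOpen 3 thetaShear hU h1

variable (G : Subgroup (Compat 3 thetaShear))

/-- **The ε-free `(β)` theta tower READ OVER THE `G`-SETS of a subgroup `G ≤ Compat₃′`** (abc-iut-L2-t2's comapped tower at the level chain of
«GRP₃′»). [cite: MochizukiEtTh2009, Def 3.3 (iii) p.299 (PDF p.73)] -/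
abbrev towerSub : LogDivisorTower G ((levelsC 3 thetaShear).comapNat id heC hbC G) := towerC₃sf.comap id heC hbC G

/-- The READING LEVEL `n(Y) ∈ ℕ` of a connected tempered `G`-set (least representative of its trace level). [cite: MochizukiEtTh2009, Def 3.3 (ii) p.299 (PDF p.73)] -/
abbrev lvlG (Y : ConnectedPart (BTemp G)) : ℕ := (levelsC 3 thetaShear).rep id G (((levelsC 3 thetaShear).comapNat id heC hbC G).lvl Y)

/-- The Def. 3.3 (iii) data of the restricted tower over `B^temp(G)⁰`. [cite: MochizukiEtTh2009, Def 3.3 (iii) p.299 (PDF p.73)] -/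
abbrev dmG : DivisorMonoids (ConnectedPart (BTemp G)) := DivisorMonoids.ofTower (towerSub G)

/-- The translation character of `G` (`φ₃` restricted). [cite: MochizukiEtTh2009, Def 3.3 (iii) p.299 (PDF p.73)] -/
abbrev φG : G →* Multiplicative ℤ := φ₃.comp G.subtype

/-- Every connected tempered `G`-covering is one orbit. [cite: MochizukiFrdII2008, Ex 1.3 (ii) p.11] -/
theorem isConnectedGSet_gsetG (Y : ConnectedPart (BTemp G)) : isConnectedGSet (gset Y) := isConnectedGSet_temperedInclusion Y

/-- Prop. 3.4 (i) (weak, cofinal perfection) at every `Φ₀(Y)` of the restricted tower. [cite: MochizukiEtTh2009, Prop 3.4 p.300 (PDF p.74)] -/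
theorem hpfG (Y : (ConnectedPart (BTemp G))ᵒᵖ) : IsPerfFactorialCof ((dmG G).Φ₀.obj Y) :=
  isPerfFactorialCof_phiZero_comap G.subtype (lvlG G Y.unop) (gset Y.unop)

/-- **The transition of `Φ₀` over `B^temp(G)⁰`: pull back along the covering map, then raise to the ramification index `eN` of the reading
levels** (abc-iut-L2-t2's `ofTower_comap_Φ₀_map_apply`, read on the `Ÿ`-skeleton — definitionally). [cite: MochizukiEtTh2009, Def 3.3 (iii) p.300 (PDF p.74)] -/
theorem Φ₀_map_hom_eq_sub {Y Y' : (ConnectedPart (BTemp G))ᵒᵖ} (f : Y ⟶ Y') (ψ : (dmG G).Φ₀.obj Y) :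
    ((dmG G).Φ₀.map f).hom ψ =
      (TateTowerTheta.action (φG G)).phiZeroPull f.unop.hom.hom ψ ^ eN (lvlG G Y.unop) (lvlG G Y'.unop) :=
  Subtype.ext (funext fun _ => rfl)

/-- Reading levels are monotone along covering maps (traces of least representatives are nested, abc-iut-L2-t2's KEY LEMMA, and levels of
«GRP₃′» are pairwise distinct). [cite: MochizukiEtTh2009, Def 3.3 (i) p.298 (PDF p.72)] -/
theorem lvlG_le_of_hom {Y Y' : ConnectedPart (BTemp G)} (f : Y' ⟶ Y) : lvlG G Y ≤ lvlG G Y' :=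
  le_of_closureC_le 3 thetaShear
    ((levelsC 3 thetaShear).closure_e_rep_le_of_le id heC G (((levelsC 3 thetaShear).comapNat id heC hbC G).closure_lvl_mono f))

/-- The ramification index along a covering map is positive. [cite: MochizukiEtTh2009, Def 3.3 (ii) p.299 (PDF p.73)] -/
theorem eN_lvlG_pos {Y Y' : (ConnectedPart (BTemp G))ᵒᵖ} (f : Y ⟶ Y') : 0 < eN (lvlG G Y.unop) (lvlG G Y'.unop) :=
  eN_pos (lvlG_le_of_hom G f.unop)

/-- **The transitions of `Φ₀` over `B^temp(G)⁰` are injective.** [cite: MochizukiEtTh2009, Def 3.3 (iii) p.300 (PDF p.74)] -/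
theorem Φ₀_map_injective_sub {Y Y' : (ConnectedPart (BTemp G))ᵒᵖ} (f : Y ⟶ Y') : Injective ((dmG G).Φ₀.map f).hom := fun _ _ h => by
  rw [Φ₀_map_hom_eq_sub, Φ₀_map_hom_eq_sub] at h
  exact phiZeroPull_injective _ f.unop.hom.hom (hom_surjective_temperedInclusion f.unop)
    (TateTowerTheta.pow_left_injective (φG G) _ (eN_lvlG_pos G f) h)

/-- **The transitions of `Φ₀` over `B^temp(G)⁰` reflect divisibility.** [cite: MochizukiEtTh2009, Def 3.3 (iii) p.300 (PDF p.74)] -/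
theorem Φ₀_map_reflects_dvd_sub {Y Y' : (ConnectedPart (BTemp G))ᵒᵖ} (f : Y ⟶ Y') (a b : (dmG G).Φ₀.obj Y)
    (h : ((dmG G).Φ₀.map f).hom a ∣ ((dmG G).Φ₀.map f).hom b) : a ∣ b := by
  rw [Φ₀_map_hom_eq_sub, Φ₀_map_hom_eq_sub] at h
  have h' : (TateTowerTheta.action (φG G)).phiZeroPull f.unop.hom.hom a ∣ (TateTowerTheta.action (φG G)).phiZeroPull f.unop.hom.hom b :=
    (TateTowerTheta.theta_pow_dvd_pow_iff (φG G) (gset Y'.unop) (eN_lvlG_pos G f)).1 h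
  exact phiZeroPull_reflects_dvd _ f.unop.hom.hom (hom_surjective_temperedInclusion f.unop) a b h'

/-! ## §2 The small index `CosetCat G` and the diagonal base data -/

variable (hG : IsTempered G)

/-- `CosetCat G ⥤ B^temp(G)⁰` ([FrdII] Ex. 1.3 (i)). [cite: MochizukiFrdII2008, Ex 1.3 (i) p.11] -/
abbrev toConnG : CosetCat G ⥤ ConnectedPart (BTemp G) := CosetCat.toConnected hG

/-- `CosetCat G ≌ B^temp(G)⁰`. [cite: MochizukiFrdII2008, Ex 1.3 (i) p.11] -/
abbrev equivConnG : CosetCat G ≌ ConnectedPart (BTemp G) := CosetCat.equivConnectedPart hG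

/-- The coset re-presentation of a connected tempered `G`-covering. [cite: MochizukiFrdII2008, Ex 1.3 (i) p.11] -/
abbrev reprG (A : ConnectedPart (BTemp G)) : ConnectedPart (BTemp G) := (toConnG G hG).obj ((equivConnG G hG).inverse.obj A)

/-- The coset re-presentation is canonically isomorphic to the covering. [cite: MochizukiFrdII2008, Ex 1.3 (i) p.11] -/
def reprGIso (A : ConnectedPart (BTemp G)) : reprG G hG A ≅ A := (equivConnG G hG).counitIso.app A

/-- The coset re-presentation has the same reading level. [cite: MochizukiEtTh2009, Def 3.3 (ii) p.299 (PDF p.73)] -/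
theorem lvlG_reprG (A : ConnectedPart (BTemp G)) : lvlG G (reprG G hG A) = lvlG G A :=
  le_antisymm (lvlG_le_of_hom G (reprGIso G hG A).inv) (lvlG_le_of_hom G (reprGIso G hG A).hom)

/-- **The Def. 3.3 (iii) data of the restricted tower RE-INDEXED over the small coset model `CosetCat G : Type 0`.**
[cite: MochizukiEtTh2009, Def 3.3 (iii) p.299 (PDF p.73)] -/
abbrev dmSubSmall : DivisorMonoids (CosetCat G) := (dmG G).precomp (toConnG G hG)

/-- Prop. 3.4 (i) at every `Φ₀(G/U)`. [cite: MochizukiEtTh2009, Prop 3.4 p.300 (PDF p.74)] -/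
theorem hpfSubSmall (Y : (CosetCat G)ᵒᵖ) : IsPerfFactorialCof ((dmSubSmall G hG).Φ₀.obj Y) := hpfG G _

/-- **Pattern diagonal base data of the restricted tower over `B^temp(G)⁰`, small index** — every field is FILE 4's at the coset re-presentation
`reprG A`, read through the comap kits at `ψ := G.subtype`: coordinates = multiplicities at the points of `reprG A` and the primes of the special fibre,
diagonal = the reduced special fibre, constants' divisors `⊆ ⟨[diag]⟩`, ramified uniformiser `div₀ ϖ = [diag]^{N_l}`.
[cite: MochizukiEtTh2009, Def 3.6 p.303 (PDF p.77)] -/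
def powDiagonalBaseSub : TemperedFrobenioid.PowDiagonalBase (dmSubSmall G hG) (ConnectedPart (BTemp G)) where
  F := (equivConnG G hG).inverse
  I A := (gset (reprG G hG A)).V × TateTowerTheta.Idx
  i₀ A := ((isConnectedGSet_gsetG G (reprG G hG A)).1.some, Sum.inr 0)
  κ A i := TateTowerTheta.coord (φG G) (gset (reprG G hG A)) i.1 i.2
  d A := TateTowerTheta.diag (φG G) (gset (reprG G hG A))
  κ_d₀ A := TateTowerTheta.coord_diag (φG G) (gset (reprG G hG A)) _ _
  eq_pow_of_κ_eq A _ c h := TateTowerTheta.coord_separating (φG G) (gset (reprG G hG A)) fun s x =>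
    (h (s, x)).trans (map_pow (TateTowerTheta.coord (φG G) (gset (reprG G hG A)) s x) _ c).symm
  div₀_mem_zpowers A _ hb :=
    divZeroHom_mem_zpowers_of_mem_fZero_comap G.subtype (lvlG G (reprG G hG A)) (isConnectedGSet_gsetG G (reprG G hG A)) hb
  exists_div₀_eq_pow A := ⟨unifPowFamComap G.subtype (lvlG G (reprG G hG A)) (gset (reprG G hG A)),
    unifPowFamComap_mem_fZero _ _ _, (N (lvlG G (reprG G hG A)) : ℕ), PNat.pos _,
    (divZeroHom_unifPowFamComap G.subtype (lvlG G (reprG G hG A)) (gset (reprG G hG A))).trans (zpow_natCast _ _)⟩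
  hΦinj f := Φ₀_map_injective_sub G ((toConnG G hG).map ((equivConnG G hG).inverse.map f)).op
  hΦrefl f a b h := Φ₀_map_reflects_dvd_sub G ((toConnG G hG).map ((equivConnG G hG).inverse.map f)).op a b h

/-- The base functor of the data is the equivalence inverse. [cite: MochizukiEtTh2009, Def 3.6 p.303 (PDF p.77)] -/
@[simp] theorem powDiagonalBaseSub_F : (powDiagonalBaseSub G hG).F = (equivConnG G hG).inverse := rfl

/-- The diagonal at `A` is the reduced special fibre on the coset re-presentation. [cite: MochizukiEtTh2009, Def 3.6 p.303 (PDF p.77)] -/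
@[simp] theorem powDiagonalBaseSub_d (A : ConnectedPart (BTemp G)) :
    (powDiagonalBaseSub G hG).d A = TateTowerTheta.diag (φG G) (gset (reprG G hG A)) := rfl

/-! ## §3 The tempered Frobenioid over `B^temp(G)⁰` with small index -/

variable (R S : ((ConnectedPart (BTemp G))ᵒᵖ ⥤ CommMonCat.{0}) → Prop)

/-- **Def. 3.6 (ii) at the ε-free `(β)` theta tower RESTRICTED TO `G`, small index**: monoid type `ℤ`, `Φ := im(Φ₀^pf → Φ₀^rlf)`, base functor
`B^temp(G)⁰ ⥤ CosetCat G` the equivalence inverse; every clause proved by the engine `ofPowDiagonalBase`. [cite: MochizukiEtTh2009, Def 3.6 p.303 (PDF p.77)] -/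
def temperedFrobenioidSub :
    TemperedFrobenioid (RealifiedDivisorMonoids.ofRlfZWeak (dmSubSmall G hG) (hpfSubSmall G hG)) (ConnectedPart (BTemp G))
      (treeCatVocab (ConnectedPart (BTemp G)) R S) :=
  TemperedFrobenioid.ofPowDiagonalBase (hpfSubSmall G hG) (powDiagonalBaseSub G hG) QuasiTemperoid.BTempConnected.connectedPart_isConnected
    QuasiTemperoid.BTempConnected.connectedPart_isTotallyEpimorphic QuasiTemperoid.BTempConnected.connectedPart_isOfFSMType R S

/-- Non-vacuity of the parameter class over `B^temp(G)⁰`. [cite: MochizukiEtTh2009, Def 3.6 p.303 (PDF p.77)] -/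
theorem nonempty_temperedFrobenioidSub :
    Nonempty (TemperedFrobenioid (RealifiedDivisorMonoids.ofRlfZWeak (dmSubSmall G hG) (hpfSubSmall G hG)) (ConnectedPart (BTemp G))
      (treeCatVocab (ConnectedPart (BTemp G)) R S)) :=
  ⟨temperedFrobenioidSub G hG R S⟩

/-- Its base functor is the equivalence inverse. [cite: MochizukiEtTh2009, Def 3.6 p.302 (PDF p.76)] -/
theorem temperedFrobenioidSub_base : (temperedFrobenioidSub G hG R S).base = (equivConnG G hG).inverse := rfl

/-- The base functor is full. [cite: MochizukiEtTh2009, Def 4.1 p.312 (PDF p.86)] -/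
theorem temperedFrobenioidSub_base_full : (temperedFrobenioidSub G hG R S).base.Full := by
  rw [temperedFrobenioidSub_base]; infer_instance

/-- The base functor is essentially surjective. [cite: MochizukiEtTh2009, Def 4.1 p.312 (PDF p.86)] -/
theorem temperedFrobenioidSub_base_essSurj : (temperedFrobenioidSub G hG R S).base.EssSurj := by
  rw [temperedFrobenioidSub_base]; infer_instance

/-- The monoid type is `ℤ`. [cite: MochizukiEtTh2009, Def 4.1 p.312 (PDF p.86)] -/
theorem temperedFrobenioidSub_monoidType : (temperedFrobenioidSub G hG R S).monoidType = MonoidType.Z := rfl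

/-- `Φ(A) = im(Φ₀(reprG A)^pf → Φ₀(reprG A)^rlf)`. [cite: MochizukiEtTh2009, Def 3.6 p.303 (PDF p.77)] -/
theorem temperedFrobenioidSub_Φ_carrier (A : (ConnectedPart (BTemp G))ᵒᵖ) :
    (temperedFrobenioidSub G hG R S).Φ.carrier A = (powDiagonalBaseSub G hG).pfImage (hpfSubSmall G hG) A := rfl

/-- Def. 3.6 (ii)(a) with content: `Φ^{bs-fld}(A) = ι(⟨diag⟩^pf)`. [cite: MochizukiEtTh2009, Def 3.6 p.303 (PDF p.77)] -/
theorem temperedFrobenioidSub_bsFld_carrier (A : (ConnectedPart (BTemp G))ᵒᵖ) :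
    (temperedFrobenioidSub G hG R S).bsFld.carrier A = (powDiagonalBaseSub G hG).diagImage (hpfSubSmall G hG) A :=
  TemperedFrobenioid.ofPowDiagonalBase_bsFld_carrier (hpfSubSmall G hG) (powDiagonalBaseSub G hG) _ _ _ R S A

/-- **It IS a Frobenioid** ([FrdI] Thm. 5.2 (ii); `hB₀inj` = the GENERIC `LogDivisorTower.ofTower_B₀_map_injective` at the restricted tower,
along `toConnected`-images). [cite: MochizukiFrdI2008, Thm. 5.2 (ii) p.100] -/
theorem isFrobenioid_temperedFrobenioidSub : PreFrobenioid.IsFrobenioid (temperedFrobenioidSub G hG R S).toElem :=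
  TemperedFrobenioid.isFrobenioid_ofPowDiagonalBase (hpfSubSmall G hG) (powDiagonalBaseSub G hG) _ _ _ R S fun g =>
    (towerSub G).ofTower_B₀_map_injective ((toConnG G hG).map g.unop).op

/-- `Φ(A)` is perfect — the `hP` slot of the §4 setting. [cite: MochizukiEtTh2009, Def 4.1 p.312 (PDF p.86)] -/
theorem hPSub (A : (ConnectedPart (BTemp G))ᵒᵖ) : IsPerfect ((temperedFrobenioidSub G hG R S).Φ.carrier A) :=
  TemperedFrobenioid.ofPowDiagonalBase_isPerfect (hpfSubSmall G hG) (powDiagonalBaseSub G hG) _ _ _ R S A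

/-- **`Φ^{bs-fld}(A) ⊊ Φ(A)` at EVERY connected tempered `G`-covering `A`** (the class of the zero divisor of `Θ̈` on `reprG A`; cusps vs components).
[cite: MochizukiEtTh2009, Def 3.6 p.303 (PDF p.77)] -/
theorem exists_mem_Φ_not_mem_bsFld_sub (A : ConnectedPart (BTemp G)) :
    ∃ x ∈ (temperedFrobenioidSub G hG R S).Φ.carrier (op A), x ∉ (temperedFrobenioidSub G hG R S).bsFld.carrier (op A) := by
  haveI : Nonempty (gset (reprG G hG A)).V := (isConnectedGSet_gsetG G (reprG G hG A)).1
  have hM := hpfSubSmall G hG (op ((equivConnG G hG).inverse.obj A))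
  refine ⟨hM.weak.toRealification (Perfection.of _ (TateTowerTheta.thetaZerosPhi (φG G) (gset (reprG G hG A)))), ⟨_, rfl⟩, ?_⟩
  rw [temperedFrobenioidSub_bsFld_carrier]
  rintro ⟨b, hb⟩
  obtain ⟨⟨c, n⟩, rfl⟩ := Perfection.mk_surjective b
  have h1 : Perfection.mk (TateTowerTheta.diag (φG G) (gset (reprG G hG A)) ^ Multiplicative.toAdd c) n =
      Perfection.mk (TateTowerTheta.thetaZerosPhi (φG G) (gset (reprG G hG A))) 1 :=
    PfImageWeak.toRealification_injective hM.weak hb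
  obtain ⟨K, hK⟩ := Perfection.mk_eq_mk_iff.mp h1
  rw [← pow_mul, PNat.one_coe, mul_one] at hK
  exact TateTowerTheta.thetaZerosPhi_pow_ne_diag_pow (φG G) (gset (reprG G hG A)) (Nat.mul_ne_zero K.ne_zero n.ne_zero) _ hK.symm

/-- `hBinj` for the realified data (the input of `hBmon`). [cite: MochizukiEtTh2009, Def 3.6 p.303 (PDF p.77)] -/
theorem hBinj_sub {Y Y' : (CosetCat G)ᵒᵖ} (g : Y ⟶ Y') :
    Injective ((RealifiedDivisorMonoids.ofRlfZWeak (dmSubSmall G hG) (hpfSubSmall G hG)).BΛ.map g).hom :=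
  RealifiedDivisorMonoids.ofRlfZWeak_hBinj (dmSubSmall G hG) (hpfSubSmall G hG)
    (fun g => (towerSub G).ofTower_B₀_map_injective ((toConnG G hG).map g.unop).op) g

/-- `hBmon`: `B` is a monoid on `B^temp(G)⁰`. [cite: MochizukiEtTh2009, Def 3.6 p.303 (PDF p.77)] -/
theorem isMonoidOn_ratFnFunctor_sub : IsMonoidOn (temperedFrobenioidSub G hG R S).ratFnFunctor :=
  (temperedFrobenioidSub G hG R S).isMonoidOn_ratFnFunctor_of_isOfFSMType (fun g => hBinj_sub G hG g)
    QuasiTemperoid.BTempConnected.connectedPart_isOfFSMType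

/-- **The [FrdI] Thm. 5.2 standing hypotheses `h` HOLD** for the model over `B^temp(G)⁰` — the input `h` of the §5 datum, NO hypothesis.
[cite: MochizukiFrdI2008, Thm. 5.2 p.100] -/
theorem hypotheses_temperedFrobenioidSub :
    ModelFrobenioid.Hypotheses (temperedFrobenioidSub G hG R S).divisorMonoid (temperedFrobenioidSub G hG R S).ratFnFunctor :=
  (temperedFrobenioidSub G hG R S).hypotheses_treeCatVocab (isMonoidOn_ratFnFunctor_sub G hG R S)

end ThetaTwistTowerSubgroup

end Literature.AnabelianGeometry.EtaleTheta

end
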